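import Literature.MathematicalPhysics.QuantumFieldTheory.Balaban1983to89.Beta.AveragedAFCarrierJsBalCauchy
import Literature.MathematicalPhysics.QuantumFieldTheory.Balaban1983to89.Beta.BalabanStepW2

/-!
# Beta / AveragedAFCarrierJsBalW2 — the whole located [III] list OVER THE WALL'S LITERAL AFTER (P4) STAGE A,
# `D1Drift Lc (JsBalW2Of hLc cE cVH cΛ hT₂ hmix) N μ ν`
# (β sub-cell, [III]-side CO-LEAD unit `b2b-balaban-strat-b14` gen 26; trigger (t1)/(t1″) of MISSING-B14 §9.37 (e)/§9.38: the second-order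
# tables of Bałaban's step jets TYPED AS A FAMILY — an2 `Beta.BalabanStepW2` v1 p194329 «the wall reads `D1Drift Lc (JsBalW2Of …) N μ ν`»)

VERSIONS
* v1 (this file; gen 26): §1 the located [III] list in (D1) currency over the Stage-A literal; §2 the closed `Π`-form with the
  second-order FAMILY `WbalOf … j` in the table slot; §3 Cauchy / limit currency over the Stage-A literal (asym1's
  `HessKerDressedLimit` producers BY NAME); §4 road B; §5 the census form of the (D1) proof route.  Theorems only; 0 `def`; 0
  `def … : Prop`; nothing of an2 / asym1 / the two certified JsBal leaves is restated except by application.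

HONEST FRAMING (page 1 of everything the β sub-cell writes): discharging `BetaPertH` makes Bałaban's UV stability UNCONDITIONAL — a
real constructive-QFT result; it is NOT the continuum limit and NOT the Clay problem.  THIS MODULE is CLASS-LEVEL BOOKKEEPING: it
instantiates this lineage's `AveragedAFCarrierJsBal` (v1 p193080: the [III] list over the closed term `D1Drift Lc (JsBalOf … W Cw δw hδw hW) N μ ν`,
the second-order tables `W` a BINDER) and `AveragedAFCarrierJsBalCauchy` (v1.1 p194093: the same list in Cauchy / limit currency) at the ONE
second-order family the wall statement is now written over — an2's `BalabanStepW2.JsBalW2Of hLc cE cVH cΛ hT₂ hmix : ℕ → JetData 3 Lc`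
(`:= JsBalOf hLc cE cVH cΛ (WbalOf 3 Lc cE cVH cΛ T₂ mixFF) (CwOf …) (δwOf …) (δwOf_pos …) (WbalOf_loc₂ …)`, `JsBalW2Of_apply` = `rfl`;
`WbalOf cE cVH cΛ T₂ mixFF j := SecondOrderResponse.W2SymOfK (KInvStep Lc j) Lc (Spure j) (M1 j) (T₂ j) (M2Of mixFF j)` — (P4) STAGE A) —
and asserts nothing printed by Bałaban; every statement is bookkeeping over the cell's hypothesis carriers, the `[cite: …]` tags being the
CONSUMER LOCATORS of the two JsBal leaves (what the END of the series consumes: [Balaban1987RG1] Thm 2 p.259 / Thm 3 p.264;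
[Balaban1988Convergent] (2.5)–(2.9), (2.28), (2.46)), nothing newly quoted.  EVERY load-bearing β-binder below (`D1Drift`, the six
(CONV-C-Cauchy) data binders, `hident`, `AllScalesSeq`, the certified list, `SDInvisible`, `D1Rep`, P5′, `hbase`, `RemainderConst`, `BetaContH`)
is a HYPOTHESIS; for the family `JsBalW2Of …` the binder `hD : D1Drift Lc (JsBalW2Of …) N μ ν` IS THE WALL (EXIT-A of the cell) — nothing
here proves it, and nothing here could: the wall is UNTOUCHED; road-(1) verdict unchanged (PRECISELY WALLED at END-STATEMENT grade; nothing
of (M2⁺)/`BetaPertH` discharged); value = census precision (MISSING-B14 §9 Table 9.1: the `hD` column of the [III] carrier is a closed term of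
the tree modulo the binders that REMAIN after Stage A — the bi-stencil tables `T₂` with `hT₂ : ∀ j, ∃ C δ, 0 < δ ∧ LocStencil₂ (T₂ j) C δ`, the
mixed table `mixFF` with `hmix : ∃ C δ, 0 < δ ∧ LocStencilFM Lc mixFF C δ` (Stage B / an1 node 12b / an3), the colour weights `cE cVH cΛ`
(P6), and — inside `Sstep`/`Spure`/`M1`/`M2Of`, BY NAME, invisible to every lemma — the PROVISIONAL UNITS numerals (P6′)), NOT summit progress.

ABSOLUTE RULE (cell charter, verbatim): "No internally-minted statement may enter as a cited fact. Every hypothesis is either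
kernel-proved in this package or a verbatim quotation of a PUBLISHED theorem with page reference. The manuscript(s) under audit are
NOT citable for their own disputed steps — they are the thing under adjudication; programme-internal (2001/route/tribunal) claims
are never citable."

## Why this leaf exists (and why it is a separate leaf)

`BETA/WALL.md` v2.18 writes the wall over `JsBalOf hLc cE cVH cΛ W Cw δw hδw hW` with the second-order tables `W …` the (P4) BINDER.  an2's
(P4) Stage A (`BalabanStepW2` v1, journal LANDED line of 2026-08-19T20:11:20Z) TYPES that binder as the family `WbalOf … j` over the two
REMAINING table binders and discharges `hδw`/`hW` for it (`δwOf_pos`, `WbalOf_loc₂`), so that the wall-facing jet datum is the literal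
`JsBalW2Of hLc cE cVH cΛ hT₂ hmix` — `JsBalOf`'s own signature being UNCHANGED (the two certified JsBal leaves of this lineage re-elaborate
byte-identically and apply to the new literal BY NAME at `W := WbalOf 3 Lc cE cVH cΛ T₂ mixFF`).  This leaf writes that application ONCE,
kernel-checked, so that a (T-def) brick / the T⁴ cell / MISSING-B14 Table 9.1 / the lead's binder check read the whole located [III] list for
the Stage-A literal off ONE theorem BY NAME whose only β-hypothesis about the family is the wall itself, with the post-Stage-A binder list
displayed in the signature:

* §1 (D1) CURRENCY: `wallEND_of_D1Drift_JsBalW2Of_cont_allProfiles` — binders = the literal's own (`hLc`, `cE cVH cΛ`, implicit `T₂`/`mixFF`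
  carried by `hT₂`/`hmix`) + EXACTLY those of `AveragedAFCarrierJsBal.wallEND_of_D1Drift_JsBalOf_cont_allProfiles` (`ForwardGenerated`, the
  split `S` with `hβ : ∀ j, S.β0 j = secondMoment (TbalOf Lc (JsBalW2Of …) j) μ ν`, **`hD : D1Drift Lc (JsBalW2Of …) N μ ν`**, (D4)
  `RemainderConst S γ₀ r` with `r < stepBal N Lc` STRICTLY, (C) `BetaContH γ₀ β`, `0 < γ₀`, the [III] run-side data) ⟹ `EndpointExistence Cn ∧
  ∃ A, ∃ γ₁ > 0, ∀ γ ≤ min γ₀ γ₁, ∀ runs in ]0,γ], ∀ p′ ≤ p, ∀ A₀ ≥ 0: sizes (2.5) ∧ HorizonFacts`, `β′ := stepBal N Lc + 2A + r`;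
  `flowIneq_…` ((2.6)–(2.9) alone at `r ≤ stepBal N Lc`, NO (C)); `t4FlowInputs_…` (C19/C20); `betaAvgAFH_…` (the minimal carrier).
* §2 THE CLOSED TERM WRITTEN OUT: `secondMoment_TbalOf_JsBalW2Of` / `d1Drift_JsBalW2Of_iff` — by an2's `BalabanStepW2.TbalOf_JsBalW2Of` the wall
  statement IS `∃ A, ∀ k, |Σ_{j<k} secondMoment (hessKer (axDressK Lc (KInvStep Lc j)) (axVertexOfK (KInvStep Lc j) Lc (JsBal⁰_j).S)
  (WbalOf 3 Lc cE cVH cΛ T₂ mixFF j)) μ ν − stepBal N Lc · k| ≤ A` — the SECOND-ORDER FAMILY in the table slot; END + carrier with `hβ` in that form.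
* §3 CAUCHY / LIMIT CURRENCY over the Stage-A literal (`AveragedAFCarrierJsBalCauchy` §3 at `W := WbalOf …`, asym1's `HessKerDressedLimit`
  producers BY NAME): `wallEND_of_cauchy_eq_JsBalW2Of_cont_allProfiles` — EXACTLY the six (CONV-C-Cauchy) data binders, the table rows now
  reading `VertexFamily₂ (WbalOf … j) Lc C₂ δ₂` (`j`-UNIFORM — Stage A's `WbalOf_loc₂` is per-`j` existential, so this row stays a binder) and
  `VertexFamily₂ (WbalOf … (k+j) − WbalOf … k) Lc (c₂ θ^k) δ₂`, + `0 ≤ θ < 1` + **`hident` at the constructed limits with `W∞ := limTabOf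
  (WbalOf 3 Lc cE cVH cΛ T₂ mixFF)`**; the named-limit form `wallEND_of_pointwise_lim_eq_JsBalW2Of_cont_allProfiles`; carriers.
* §4 ROAD B over the Stage-A literal (no identification, no wall): `allScalesConst_END_JsBalW2Of_allProfiles_cont` + carrier (defect 0).
* §5 THE CENSUS FORM of the (D1) proof route (RULING (R28-1): P5′ · `hbase` · (SDF) · `D1Rep`) over the Stage-A literal, `Jc` a binder.

Every OTHER currency form of the two JsBal leaves (`…_of_allScales_lim_eq_…`, `…_of_pointwise_limKernel_eq_…`, road-B `flowIneq`/`t4FlowInputs`,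
the joined pointwise road-B END with asym1's explicit `κ`) applies to the Stage-A literal BY NAME in the same way (W-data slots `_`); they are
not re-typed here.  A SEPARATE LEAF, not a v1.1/v1.2 of the JsBal leaves: those are cross-read and certified byte-for-byte (C-lit1g24-3,
C-beta-348, C-lit2g21-8) and must not acquire `BalabanStepW2`'s `SecondOrderResponse` closure; no import cycle (`BalabanStepW2` imports
`SecondOrderResponse` only, whose closure contains no `AveragedAFCarrier*` module).  GENERIC over the table binders: when Stage B (an2, v1.1
of `BalabanStepW2`, additive) pins `T₂ := T2Of …`, every theorem here instantiates BY NAME at the pinned `hT₂`; nothing in this file changes.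
EXPONENT-AGNOSTIC: the PROVISIONAL (P6′) numerals live inside `Sstep`/`Spure`/`M1`/`M2Of` and are never unfolded here.

NON-VACUITY.  For an ABSTRACT `Js` the END binder list is jointly inhabited (lead `Beta.WallWitness`; `StepDriftWitness.d1Drift_inhabited` /
`d1Drift_genuine`); the abstract road-B list with positive slope (`AveragedAFCarrierAllScales` §5).  For the literal `JsBalW2Of …` the
inhabitation of `hD` / `hident` / the (CONV-C-Cauchy) rows / `hall`'s suppliers IS EXACTLY the open wall and the sub-cell's open supplier
rows — no witness is offered or possible here, by design; the theorems are implications.  READING CLAUSE (W-KKT-2) as in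
`AveragedAFCarrierJsBal` / `OneStepKernelFamily` / `BalabanStepJetsSucc` / `BalabanStepW2` (headers): the identification of the `μ ≠ ν` second
moment of `TbalOf Lc (JsBalW2Of …) j` with the printed (1.22) coefficient of [Balaban1987RG1] p. 264 is the sub-cell's READING, delivered
with (T-def) — NOT asserted by any theorem here; `BalabanStepW2`'s ORDER-ONE CONSISTENCY paragraph is prose there and nothing here.

Source located (consumer locators, quoted verbatim in `B14FlowStep` / `AveragedAFCarrier`, nothing newly quoted): [Balaban1987RG1,
Thm 2 p.259, Thm 3 p.264]; [Balaban1988Convergent, (2.5)–(2.9) pp.255–256, (2.28) p.259, (2.46) p.263].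
-/

noncomputable section

namespace Literature.MathematicalPhysics.QuantumFieldTheory.Balaban1983to89.Beta.AveragedAFCarrierJsBalW2

open Finset
open Literature.MathematicalPhysics.QuantumFieldTheory.Balaban1983to89
open FlowStep FlowStepRuns DagBinding B14DeltaBeta
open Literature.MathematicalPhysics.QuantumFieldTheory.Balaban1983to89.Beta.Drift (OneLoopDrift)
open Literature.MathematicalPhysics.QuantumFieldTheory.Balaban1983to89.Beta.RemainderChain (RemainderConst)
open Literature.MathematicalPhysics.QuantumFieldTheory.Balaban1983to89.Beta.RemainderConstAllScales (AllScalesSeq)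
open Literature.MathematicalPhysics.QuantumFieldTheory.Balaban1983to89.Beta.VectorTailsLoc (fam kfam)
open Literature.MathematicalPhysics.QuantumFieldTheory.Balaban1983to89.Beta.VectorLegVolumeAdapter (MvE)
open Literature.MathematicalPhysics.QuantumFieldTheory.Balaban1983to89.Beta.OneStepResolventKernel (Fib LocStencil JetData)
open Literature.MathematicalPhysics.QuantumFieldTheory.Balaban1983to89.Beta.OneStepKernelFamily
  (KInvStep TbalOf TshotOf D1Rep D1Drift)
open Literature.MathematicalPhysics.QuantumFieldTheory.Balaban1983to89.Beta.StepDriftWitness (SDInvisible)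
open Literature.MathematicalPhysics.QuantumFieldTheory.Balaban1983to89.Beta.AxialDressing (axDressK axVertexOfK)
open Literature.MathematicalPhysics.QuantumFieldTheory.Balaban1983to89.Beta.BalabanStepJetsSucc (JsBal0Of JsBalOf)
open Literature.MathematicalPhysics.QuantumFieldTheory.Balaban1983to89.Beta.BalabanCompositeJets (LocStencil₂)
open Literature.MathematicalPhysics.QuantumFieldTheory.Balaban1983to89.Beta.SecondOrderResponse (LocStencilFM)
open Literature.MathematicalPhysics.QuantumFieldTheory.Balaban1983to89.Beta.BalabanStepW2
  (WbalOf CwOf δwOf δwOf_pos WbalOf_loc₂ JsBalW2Of TbalOf_JsBalW2Of)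
open Literature.MathematicalPhysics.QuantumFieldTheory.Balaban1983to89.B12Beta (secondMoment)
open ExpKernelCalculus (MKer Decays VertexFamily₂ hessKer)
open Literature.MathematicalPhysics.QuantumFieldTheory.Balaban1983to89.Beta.HessKerDressedLimit (limMKerOf limStOf limTabOf)
open ComposedRoad AveragedAFCarrier AveragedAFCarrierStepDrift AveragedAFCarrierJsBal AveragedAFCarrierAllScales
  AveragedAFCarrierJsBalCauchy

variable {β : HBeta} {Lc : ℕ} [NeZero Lc] {Λ : Type*}
  (hLc : 1 ≤ Lc) (cE cVH cΛ : ℝ)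
  {T₂ : ℕ → Fin (3 + 1) → (Fin (3 + 1) → ℤ) → Fin (3 + 1) → (Fin (3 + 1) → ℤ) → MKer (3 + 1) (Fib 3)}
  {mixFF : Fin (3 + 1) → (Fin (3 + 1) → ℤ) → Fin (3 + 1) → (Fin (3 + 1) → ℤ) → MKer (3 + 1) (Fib 3)}
  (hT₂ : ∀ j, ∃ C δ : ℝ, 0 < δ ∧ LocStencil₂ (T₂ j) C δ) (hmix : ∃ C δ : ℝ, 0 < δ ∧ LocStencilFM Lc mixFF C δ)

/-! ## §1 (D1) currency: the wall's Stage-A literal `D1Drift Lc (JsBalW2Of …) N μ ν` ⟹ the whole located [III] list (statement form) -/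

section StatementForm

/-- **THE WHOLE LOCATED [III] LIST OVER THE WALL'S STAGE-A LITERAL, ALL PROFILES** — `AveragedAFCarrierJsBal.wallEND_of_D1Drift_JsBalOf_cont_allProfiles`
at `W := WbalOf 3 Lc cE cVH cΛ T₂ mixFF`, `Cw δw hδw hW := CwOf … / δwOf … / δwOf_pos … / WbalOf_loc₂ …` (an2 `BalabanStepW2.JsBalW2Of_apply`, `rfl`):
binders = the literal's own (`hLc`, (P6) `cE cVH cΛ`, the two REMAINING table binders `T₂`/`mixFF` through `hT₂`/`hmix`) + `ForwardGenerated`,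
the split `S` with `hβ` (the split's one-loop numbers ARE the `μ ≠ ν` second moments of the literal's step kernels), **THE WALL
`hD : D1Drift Lc (JsBalW2Of hLc cE cVH cΛ hT₂ hmix) N μ ν`**, **(D4) `RemainderConst S γ₀ r` with `r < stepBal N Lc` STRICTLY**, **(C) `BetaContH γ₀ β`**,
`0 < γ₀` and the [III] run-side data ⟹ `EndpointExistence Cn ∧ ∃ A, ∃ γ₁ > 0, ∀ γ ≤ min γ₀ γ₁, ∀ runs in ]0,γ], ∀ p′ ≤ p, ∀ A₀ ≥ 0: sizes ∧
HorizonFacts` with `β′ := stepBal N Lc + 2A + r`.  Discharges nothing of `BetaPertH` (`hD` is the wall).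
[cite: Balaban1987RG1, Thm 2 p.259 and Thm 3 p.264] [cite: Balaban1988Convergent, (2.5)–(2.9) pp.255–256, (2.28) p.259, (2.46) p.263] -/
theorem wallEND_of_D1Drift_JsBalW2Of_cont_allProfiles {Cn : B12.Construction} (hgen : ForwardGenerated Cn β)
    (hhalt : HaltsOutside Cn β) (hcur : CurriesHBeta Cn β) (S : B12Beta.OneLoopSplit β) {N : ℝ} {μ ν : Fin 4}
    (hβ : ∀ j, S.β0 j = secondMoment (TbalOf Lc (JsBalW2Of hLc cE cVH cΛ hT₂ hmix) j) μ ν)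
    (hD : D1Drift Lc (JsBalW2Of hLc cE cVH cΛ hT₂ hmix) N μ ν) {γ₀ r β₀ : ℝ}
    (hγ₀ : 0 < γ₀) (hrem : RemainderConst S γ₀ r) (hr : r < B12Normalization.stepBal N Lc) (hcont : BetaContH γ₀ β)
    (hβ₀ : 0 < β₀) {L : ℕ} (hL2 : 2 ≤ L) (p : ℕ) {κ₀ : ℕ} (hκ : 6 ≤ κ₀) :
    EndpointExistence Cn ∧ ∃ A : ℝ, ∃ γ₁ : ℝ, 0 < γ₁ ∧
      ∀ γ : ℝ, 0 < γ → γ ≤ min γ₀ γ₁ → ∀ Pr : B12.RunParams, (Cn Pr).flow.InInterval γ Pr.K →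
        ∀ p' : ℕ, p' ≤ p → ∀ A₀ : ℝ, 0 ≤ A₀ →
          ∃ Rj : ℕ → ℕ, (∀ j, B14.IsRj L p' ((Cn Pr).flow.g j) (Rj j)) ∧
            HorizonFacts (Cn Pr).flow (B12Normalization.stepBal N Lc + 2 * A + r) β₀ A₀ L p' κ₀ Rj Pr.K :=
  wallEND_of_D1Drift_JsBalOf_cont_allProfiles hLc cE cVH cΛ (WbalOf 3 Lc cE cVH cΛ T₂ mixFF) (CwOf hLc cE cVH cΛ hT₂ hmix)
    (δwOf hLc cE cVH cΛ hT₂ hmix) (δwOf_pos hLc cE cVH cΛ hT₂ hmix) (WbalOf_loc₂ hLc cE cVH cΛ hT₂ hmix) hgen hhalt hcur S hβ hD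
    hγ₀ hrem hr hcont hβ₀ hL2 p hκ

/-- **… AT `r ≤ stepBal N Lc`, NO (C): (2.6)–(2.9) FOR ALL PROFILES** over the Stage-A literal (β′ := stepBal N Lc + 2A + r, `A` the
drift's defect) — `AveragedAFCarrierJsBal.flowIneq_of_D1Drift_JsBalOf_allProfiles` at `W := WbalOf …`. [cite: Balaban1988Convergent, (2.5)–(2.9) pp.255–256] -/
theorem flowIneq_of_D1Drift_JsBalW2Of_allProfiles {Cn : B12.Construction} (hgen : ForwardGenerated Cn β)
    (hhalt : HaltsOutside Cn β) (hcur : CurriesHBeta Cn β) (S : B12Beta.OneLoopSplit β) {N : ℝ} {μ ν : Fin 4}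
    (hβ : ∀ j, S.β0 j = secondMoment (TbalOf Lc (JsBalW2Of hLc cE cVH cΛ hT₂ hmix) j) μ ν)
    (hD : D1Drift Lc (JsBalW2Of hLc cE cVH cΛ hT₂ hmix) N μ ν) {γ₀ r β₀ : ℝ}
    (hγ₀ : 0 < γ₀) (hrem : RemainderConst S γ₀ r) (hr : r ≤ B12Normalization.stepBal N Lc) (hβ₀ : 0 < β₀) {L : ℕ}
    (hL2 : 2 ≤ L) (p : ℕ) :
    ∃ A : ℝ, ∃ γ₁ : ℝ, 0 < γ₁ ∧
      ∀ γ : ℝ, 0 < γ → γ ≤ min γ₀ γ₁ → ∀ Pr : B12.RunParams, (Cn Pr).flow.InInterval γ Pr.K →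
        ∀ p' : ℕ, p' ≤ p → ∀ A₀ : ℝ, 0 ≤ A₀ →
          ∃ Rj : ℕ → ℕ, (∀ j, B14.IsRj L p' ((Cn Pr).flow.g j) (Rj j)) ∧
            B14.FlowIneq26 (Cn Pr).flow.g (B12Normalization.stepBal N Lc + 2 * A + r) β₀ Pr.K ∧
            B14.FlowIneq27 (Cn Pr).flow.g (B12Normalization.stepBal N Lc + 2 * A + r) β₀ p' Pr.K ∧
            B14.FlowIneq28 (epsK A₀ p' (Cn Pr).flow) (Cn Pr).flow.g (B12Normalization.stepBal N Lc + 2 * A + r) β₀ Pr.K ∧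
            B14FlowStep.FlowIneq29 Rj (Cn Pr).flow.g L (B12Normalization.stepBal N Lc + 2 * A + r) β₀ Pr.K :=
  flowIneq_of_D1Drift_JsBalOf_allProfiles hLc cE cVH cΛ (WbalOf 3 Lc cE cVH cΛ T₂ mixFF) (CwOf hLc cE cVH cΛ hT₂ hmix)
    (δwOf hLc cE cVH cΛ hT₂ hmix) (δwOf_pos hLc cE cVH cΛ hT₂ hmix) (WbalOf_loc₂ hLc cE cVH cΛ hT₂ hmix) hgen hhalt hcur S hβ hD
    hγ₀ hrem hr hβ₀ hL2 p

/-- **… AT `r ≤ stepBal N Lc`, NO (C): THE T⁴ CELL's FLOW-FACT BINDERS (MISSING-B14 §8 C19/C20) over the Stage-A literal** —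
`AveragedAFCarrierJsBal.t4FlowInputs_of_D1Drift_JsBalOf` at `W := WbalOf …`. [cite: Balaban1988Convergent, (2.5)–(2.9) pp.255–256] -/
theorem t4FlowInputs_of_D1Drift_JsBalW2Of {Cn : B12.Construction} (hgen : ForwardGenerated Cn β)
    (hhalt : HaltsOutside Cn β) (hcur : CurriesHBeta Cn β) (S : B12Beta.OneLoopSplit β) {N : ℝ} {μ ν : Fin 4}
    (hβ : ∀ j, S.β0 j = secondMoment (TbalOf Lc (JsBalW2Of hLc cE cVH cΛ hT₂ hmix) j) μ ν)
    (hD : D1Drift Lc (JsBalW2Of hLc cE cVH cΛ hT₂ hmix) N μ ν) {γ₀ r β₀ : ℝ}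
    (hγ₀ : 0 < γ₀) (hrem : RemainderConst S γ₀ r) (hr : r ≤ B12Normalization.stepBal N Lc) (hβ₀ : 0 < β₀) {L : ℕ}
    (hL2 : 2 ≤ L) {p₀ r' : ℕ} (hr' : r' ≤ p₀) :
    ∃ A : ℝ, ∃ γ₁ : ℝ, 0 < γ₁ ∧ ∀ γ : ℝ, 0 < γ → γ ≤ min γ₀ γ₁ → ∀ Pr : B12.RunParams, (Cn Pr).flow.InInterval γ Pr.K →
      B14.FlowIneq27 (Cn Pr).flow.g (B12Normalization.stepBal N Lc + 2 * A + r) β₀ p₀ Pr.K ∧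
      (∀ j, j ≤ Pr.K → 1 ≤ Real.log (((Cn Pr).flow.g j) ^ 2)⁻¹) ∧
      ∃ Rj : ℕ → ℕ, (∀ j, B14.IsRj L r' ((Cn Pr).flow.g j) (Rj j)) ∧
        B14FlowStep.FlowIneq29 Rj (Cn Pr).flow.g L (B12Normalization.stepBal N Lc + 2 * A + r) β₀ Pr.K :=
  t4FlowInputs_of_D1Drift_JsBalOf hLc cE cVH cΛ (WbalOf 3 Lc cE cVH cΛ T₂ mixFF) (CwOf hLc cE cVH cΛ hT₂ hmix)
    (δwOf hLc cE cVH cΛ hT₂ hmix) (δwOf_pos hLc cE cVH cΛ hT₂ hmix) (WbalOf_loc₂ hLc cE cVH cΛ hT₂ hmix) hgen hhalt hcur S hβ hD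
    hγ₀ hrem hr hβ₀ hL2 hr'

/-- **THE MINIMAL [III] CARRIER OVER THE STAGE-A LITERAL**: the wall `D1Drift Lc (JsBalW2Of …) N μ ν` + `hβ` + (D4) `RemainderConst S γ r`
⟹ `∃ A, BetaAvgAFH (stepBal N Lc − r) (2A) γ β` (MISSING-B14 §9 Table 9.1: slope `stepBal − r`, defect twice the drift's; slope `> 0` iff
`r < stepBal N Lc`) — `AveragedAFCarrierJsBal.betaAvgAFH_of_D1Drift_JsBalOf` at `W := WbalOf …`; the carrier is the (2.46)-consumer's
averaged asymptotic freedom along runs. [cite: Balaban1987RG1, Thm 2 p.259 and §1 p.264] [cite: Balaban1988Convergent, (2.46) p.263] -/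
theorem betaAvgAFH_of_D1Drift_JsBalW2Of (S : B12Beta.OneLoopSplit β) {N : ℝ} {μ ν : Fin 4}
    (hβ : ∀ j, S.β0 j = secondMoment (TbalOf Lc (JsBalW2Of hLc cE cVH cΛ hT₂ hmix) j) μ ν)
    (hD : D1Drift Lc (JsBalW2Of hLc cE cVH cΛ hT₂ hmix) N μ ν) {γ r : ℝ} (hrem : RemainderConst S γ r) :
    ∃ A : ℝ, BetaAvgAFH (B12Normalization.stepBal N Lc - r) (2 * A) γ β :=
  betaAvgAFH_of_D1Drift_JsBalOf hLc cE cVH cΛ (WbalOf 3 Lc cE cVH cΛ T₂ mixFF) (CwOf hLc cE cVH cΛ hT₂ hmix)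
    (δwOf hLc cE cVH cΛ hT₂ hmix) (δwOf_pos hLc cE cVH cΛ hT₂ hmix) (WbalOf_loc₂ hLc cE cVH cΛ hT₂ hmix) S hβ hD hrem

end StatementForm

/-! ## §2 The Stage-A literal written out: the wall in closed `Π`-form with the second-order FAMILY in the table slot
(`BalabanStepW2.TbalOf_JsBalW2Of`) -/

section ClosedForm

/-- **THE LITERAL'S ONE-LOOP NUMBERS, MEMBER BY MEMBER, IN CLOSED `Π`-FORM**: the `(μ, ν)` second moment of the wall's `j`-th step kernel
after Stage A is that of `hessKer (Πᵀ·KInvStep Lc j·Π) (V^Π_{KInvStep Lc j} S_j) (WbalOf 3 Lc cE cVH cΛ T₂ mixFF j)` with `S_j = (JsBal⁰_j).S`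
Bałaban's undressed stencil and the SECOND-ORDER FAMILY `WbalOf … j = W2SymOfK (KInvStep Lc j) Lc (Spure j) (M1 j) (T₂ j) (M2Of mixFF j)` in
the table slot — an2's `TbalOf_JsBalW2Of` under `secondMoment`.  A standard unfolding lemma. [folklore] -/
theorem secondMoment_TbalOf_JsBalW2Of (j : ℕ) (μ ν : Fin 4) :
    secondMoment (TbalOf Lc (JsBalW2Of hLc cE cVH cΛ hT₂ hmix) j) μ ν
      = secondMoment (hessKer (axDressK Lc (KInvStep (d := 3) Lc j))
          (axVertexOfK (KInvStep (d := 3) Lc j) Lc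
            (JsBal0Of hLc cE cVH cΛ (WbalOf 3 Lc cE cVH cΛ T₂ mixFF) (CwOf hLc cE cVH cΛ hT₂ hmix) (δwOf hLc cE cVH cΛ hT₂ hmix)
              (δwOf_pos hLc cE cVH cΛ hT₂ hmix) (WbalOf_loc₂ hLc cE cVH cΛ hT₂ hmix) j).S)
          (WbalOf 3 Lc cE cVH cΛ T₂ mixFF j)) μ ν := by
  rw [TbalOf_JsBalW2Of]

/-- **THE WALL STATEMENT AFTER STAGE A, WRITTEN OUT** (unfolded once through `D1Drift` and `TbalOf_JsBalW2Of`):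
`D1Drift Lc (JsBalW2Of …) N μ ν` IS «the `(μ, ν)` second moments of the `Πᵀ·K_j·Π`-Hessian kernels with Bałaban's stencils `S_j` and the
second-order family `WbalOf … j` drift with the asymptotic-freedom slope `stepBal N Lc = (11N²/(12π²))·log Lc` up to a bounded cumulative
defect»: `∃ A, ∀ k, |Σ_{j<k} secondMoment (hessKer (axDressK Lc (KInvStep Lc j)) (axVertexOfK (KInvStep Lc j) Lc (JsBal⁰_j).S)
(WbalOf 3 Lc cE cVH cΛ T₂ mixFF j)) μ ν − stepBal N Lc · k| ≤ A`.  A restatement of the hypothesis, not a step towards it; a standard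
unfolding lemma. [folklore] -/
theorem d1Drift_JsBalW2Of_iff {N : ℝ} {μ ν : Fin 4} :
    D1Drift Lc (JsBalW2Of hLc cE cVH cΛ hT₂ hmix) N μ ν ↔
      ∃ A : ℝ, ∀ k : ℕ,
        |∑ j ∈ Finset.range k,
            secondMoment (hessKer (axDressK Lc (KInvStep (d := 3) Lc j))
              (axVertexOfK (KInvStep (d := 3) Lc j) Lc
                (JsBal0Of hLc cE cVH cΛ (WbalOf 3 Lc cE cVH cΛ T₂ mixFF) (CwOf hLc cE cVH cΛ hT₂ hmix)
                  (δwOf hLc cE cVH cΛ hT₂ hmix) (δwOf_pos hLc cE cVH cΛ hT₂ hmix) (WbalOf_loc₂ hLc cE cVH cΛ hT₂ hmix) j).S)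
              (WbalOf 3 Lc cE cVH cΛ T₂ mixFF j)) μ ν
          - B12Normalization.stepBal N Lc * k| ≤ A := by
  have h : (fun j => secondMoment (TbalOf Lc (JsBalW2Of hLc cE cVH cΛ hT₂ hmix) j) μ ν)
      = fun j => secondMoment (hessKer (axDressK Lc (KInvStep (d := 3) Lc j))
          (axVertexOfK (KInvStep (d := 3) Lc j) Lc
            (JsBal0Of hLc cE cVH cΛ (WbalOf 3 Lc cE cVH cΛ T₂ mixFF) (CwOf hLc cE cVH cΛ hT₂ hmix)
              (δwOf hLc cE cVH cΛ hT₂ hmix) (δwOf_pos hLc cE cVH cΛ hT₂ hmix) (WbalOf_loc₂ hLc cE cVH cΛ hT₂ hmix) j).S)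
          (WbalOf 3 Lc cE cVH cΛ T₂ mixFF j)) μ ν := by
    funext j; rw [TbalOf_JsBalW2Of]
  unfold D1Drift OneLoopDrift
  rw [h]

/-- **THE [III] LIST OVER THE STAGE-A LITERAL WITH `hβ` IN CLOSED `Π`-FORM** — §1 `wallEND_of_D1Drift_JsBalW2Of_cont_allProfiles` with the
split's numbers given directly as the second moments of the `Πᵀ·K_j·Π`-Hessian kernels carrying the second-order family (`hβ` rewritten by
`secondMoment_TbalOf_JsBalW2Of`); same conclusion, same `β′ := stepBal N Lc + 2A + r`.  Discharges nothing of `BetaPertH`.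
[cite: Balaban1987RG1, Thm 2 p.259 and Thm 3 p.264] [cite: Balaban1988Convergent, (2.5)–(2.9) pp.255–256, (2.28) p.259, (2.46) p.263] -/
theorem wallEND_of_D1Drift_JsBalW2Of_closedForm_cont_allProfiles {Cn : B12.Construction} (hgen : ForwardGenerated Cn β)
    (hhalt : HaltsOutside Cn β) (hcur : CurriesHBeta Cn β) (S : B12Beta.OneLoopSplit β) {N : ℝ} {μ ν : Fin 4}
    (hβ : ∀ j, S.β0 j = secondMoment (hessKer (axDressK Lc (KInvStep (d := 3) Lc j))
      (axVertexOfK (KInvStep (d := 3) Lc j) Lc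
        (JsBal0Of hLc cE cVH cΛ (WbalOf 3 Lc cE cVH cΛ T₂ mixFF) (CwOf hLc cE cVH cΛ hT₂ hmix)
          (δwOf hLc cE cVH cΛ hT₂ hmix) (δwOf_pos hLc cE cVH cΛ hT₂ hmix) (WbalOf_loc₂ hLc cE cVH cΛ hT₂ hmix) j).S)
      (WbalOf 3 Lc cE cVH cΛ T₂ mixFF j)) μ ν)
    (hD : D1Drift Lc (JsBalW2Of hLc cE cVH cΛ hT₂ hmix) N μ ν) {γ₀ r β₀ : ℝ}
    (hγ₀ : 0 < γ₀) (hrem : RemainderConst S γ₀ r) (hr : r < B12Normalization.stepBal N Lc) (hcont : BetaContH γ₀ β)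
    (hβ₀ : 0 < β₀) {L : ℕ} (hL2 : 2 ≤ L) (p : ℕ) {κ₀ : ℕ} (hκ : 6 ≤ κ₀) :
    EndpointExistence Cn ∧ ∃ A : ℝ, ∃ γ₁ : ℝ, 0 < γ₁ ∧
      ∀ γ : ℝ, 0 < γ → γ ≤ min γ₀ γ₁ → ∀ Pr : B12.RunParams, (Cn Pr).flow.InInterval γ Pr.K →
        ∀ p' : ℕ, p' ≤ p → ∀ A₀ : ℝ, 0 ≤ A₀ →
          ∃ Rj : ℕ → ℕ, (∀ j, B14.IsRj L p' ((Cn Pr).flow.g j) (Rj j)) ∧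
            HorizonFacts (Cn Pr).flow (B12Normalization.stepBal N Lc + 2 * A + r) β₀ A₀ L p' κ₀ Rj Pr.K :=
  wallEND_of_D1Drift_JsBalW2Of_cont_allProfiles hLc cE cVH cΛ hT₂ hmix hgen hhalt hcur S
    (fun j => by rw [secondMoment_TbalOf_JsBalW2Of]; exact hβ j) hD hγ₀ hrem hr hcont hβ₀ hL2 p hκ

/-- **THE MINIMAL [III] CARRIER WITH `hβ` IN CLOSED `Π`-FORM** over the Stage-A literal: `∃ A, BetaAvgAFH (stepBal N Lc − r) (2A) γ β`.
[cite: Balaban1987RG1, Thm 2 p.259 and §1 p.264] [cite: Balaban1988Convergent, (2.46) p.263] -/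
theorem betaAvgAFH_of_D1Drift_JsBalW2Of_closedForm (S : B12Beta.OneLoopSplit β) {N : ℝ} {μ ν : Fin 4}
    (hβ : ∀ j, S.β0 j = secondMoment (hessKer (axDressK Lc (KInvStep (d := 3) Lc j))
      (axVertexOfK (KInvStep (d := 3) Lc j) Lc
        (JsBal0Of hLc cE cVH cΛ (WbalOf 3 Lc cE cVH cΛ T₂ mixFF) (CwOf hLc cE cVH cΛ hT₂ hmix)
          (δwOf hLc cE cVH cΛ hT₂ hmix) (δwOf_pos hLc cE cVH cΛ hT₂ hmix) (WbalOf_loc₂ hLc cE cVH cΛ hT₂ hmix) j).S)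
      (WbalOf 3 Lc cE cVH cΛ T₂ mixFF j)) μ ν)
    (hD : D1Drift Lc (JsBalW2Of hLc cE cVH cΛ hT₂ hmix) N μ ν) {γ r : ℝ} (hrem : RemainderConst S γ r) :
    ∃ A : ℝ, BetaAvgAFH (B12Normalization.stepBal N Lc - r) (2 * A) γ β :=
  betaAvgAFH_of_D1Drift_JsBalW2Of hLc cE cVH cΛ hT₂ hmix S
    (fun j => by rw [secondMoment_TbalOf_JsBalW2Of]; exact hβ j) hD hrem

end ClosedForm

/-! ## §3 Cauchy / limit currency over the Stage-A literal (`AveragedAFCarrierJsBalCauchy` §3 at `W := WbalOf …`; asym1's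
`HessKerDressedLimit` producers BY NAME) -/

section LimitCurrency

variable {R C cK δK Cs cS δS C₂ c₂ δ₂ θ : ℝ}
  {Kinf : MKer 4 (Fib 3)} {Sinf : Fin 4 → (Fin 4 → ℤ) → MKer 4 (Fib 3)}
  {Winf : Fin 4 → (Fin 4 → ℤ) → Fin 4 → (Fin 4 → ℤ) → MKer 4 (Fib 3)}

/-- **THE WHOLE LOCATED [III] LIST OVER THE STAGE-A LITERAL FROM (CONV-C-Cauchy) + THE EXPLICIT IDENTIFICATION AT THE CONSTRUCTED LIMITS,
ALL PROFILES** — `AveragedAFCarrierJsBalCauchy.wallEND_of_cauchy_eq_JsBalOf_cont_allProfiles` at `W := WbalOf 3 Lc cE cVH cΛ T₂ mixFF`: EXACTLY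
the six (CONV-C-Cauchy) data binders on the UNDRESSED primitives of the literal — `j`-uniform `Decays (KInvStep Lc j) C δK`,
`LocStencil (JsBal⁰_j).S Cs δS`, **`VertexFamily₂ (WbalOf … j) Lc C₂ δ₂`** (a `j`-UNIFORM table row: Stage A's `WbalOf_loc₂` is per-`j`
existential, so this stays a binder) and the all-scales deviations `Decays (KInvStep Lc (k+j) − KInvStep Lc k) (cK θ^k) δK`, …,
**`VertexFamily₂ (WbalOf … (k+j) − WbalOf … k) Lc (c₂ θ^k) δ₂`**; `0 < R < δK`, `R/2 < δS`, `R < δ₂`; `0 ≤ θ < 1` — + **`hident :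
secondMoment (hessKer (axDressK Lc K∞) (axVertexOfK K∞ Lc S∞) W∞) μ ν = stepBal N Lc` at `K∞ := limMKerOf (KInvStep Lc)`,
`S∞ := limStOf (j ↦ (JsBal⁰_j).S)`, `W∞ := limTabOf (WbalOf 3 Lc cE cVH cΛ T₂ mixFF)`** (asym1's `HessKerDressedLimit.d1Drift_JsBalOf_of_cauchy_eq`
produces the wall `hD`), then §1: `ForwardGenerated`, the split `S` with `hβ`, (D4) STRICT, (C), `0 < γ₀`, run-side ⟹ the conclusion of
`wallEND_of_D1Drift_JsBalW2Of_cont_allProfiles`.  Discharges nothing of `BetaPertH`: the six data binders are located-unprinted hypothesis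
shapes and `hident` is the wall, read explicitly.
[cite: Balaban1987RG1, Thm 2 p.259 and Thm 3 p.264] [cite: Balaban1988Convergent, (2.5)–(2.9) pp.255–256, (2.28) p.259, (2.46) p.263] -/
theorem wallEND_of_cauchy_eq_JsBalW2Of_cont_allProfiles
    (hK : ∀ j, Decays (KInvStep (d := 3) Lc j) C δK)
    (hKall : ∀ k j, Decays (KInvStep (d := 3) Lc (k + j) - KInvStep (d := 3) Lc k) (cK * θ ^ k) δK)
    (hS : ∀ j, LocStencil (JsBal0Of hLc cE cVH cΛ (WbalOf 3 Lc cE cVH cΛ T₂ mixFF) (CwOf hLc cE cVH cΛ hT₂ hmix)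
      (δwOf hLc cE cVH cΛ hT₂ hmix) (δwOf_pos hLc cE cVH cΛ hT₂ hmix) (WbalOf_loc₂ hLc cE cVH cΛ hT₂ hmix) j).S Cs δS)
    (hSall : ∀ k j, LocStencil
      ((JsBal0Of hLc cE cVH cΛ (WbalOf 3 Lc cE cVH cΛ T₂ mixFF) (CwOf hLc cE cVH cΛ hT₂ hmix)
          (δwOf hLc cE cVH cΛ hT₂ hmix) (δwOf_pos hLc cE cVH cΛ hT₂ hmix) (WbalOf_loc₂ hLc cE cVH cΛ hT₂ hmix) (k + j)).S
        - (JsBal0Of hLc cE cVH cΛ (WbalOf 3 Lc cE cVH cΛ T₂ mixFF) (CwOf hLc cE cVH cΛ hT₂ hmix)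
          (δwOf hLc cE cVH cΛ hT₂ hmix) (δwOf_pos hLc cE cVH cΛ hT₂ hmix) (WbalOf_loc₂ hLc cE cVH cΛ hT₂ hmix) k).S) (cS * θ ^ k) δS)
    (hW₂ : ∀ j, VertexFamily₂ (WbalOf 3 Lc cE cVH cΛ T₂ mixFF j) Lc C₂ δ₂)
    (hW₂all : ∀ k j, VertexFamily₂ (WbalOf 3 Lc cE cVH cΛ T₂ mixFF (k + j) - WbalOf 3 Lc cE cVH cΛ T₂ mixFF k) Lc (c₂ * θ ^ k) δ₂)
    (hR : 0 < R) (hRK : R < δK) (hRS : R / 2 < δS) (hRW : R < δ₂) (hθ0 : 0 ≤ θ) (hθ1 : θ < 1) {μ ν : Fin 4} {N : ℝ}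
    (hident : secondMoment (hessKer (axDressK Lc (limMKerOf (KInvStep (d := 3) Lc)))
        (axVertexOfK (limMKerOf (KInvStep (d := 3) Lc)) Lc (limStOf fun j =>
          (JsBal0Of hLc cE cVH cΛ (WbalOf 3 Lc cE cVH cΛ T₂ mixFF) (CwOf hLc cE cVH cΛ hT₂ hmix)
            (δwOf hLc cE cVH cΛ hT₂ hmix) (δwOf_pos hLc cE cVH cΛ hT₂ hmix) (WbalOf_loc₂ hLc cE cVH cΛ hT₂ hmix) j).S))
        (limTabOf (WbalOf 3 Lc cE cVH cΛ T₂ mixFF))) μ ν = B12Normalization.stepBal N Lc)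
    {Cn : B12.Construction} (hgen : ForwardGenerated Cn β) (hhalt : HaltsOutside Cn β) (hcur : CurriesHBeta Cn β)
    (S : B12Beta.OneLoopSplit β)
    (hβ : ∀ j, S.β0 j = secondMoment (TbalOf Lc (JsBalW2Of hLc cE cVH cΛ hT₂ hmix) j) μ ν) {γ₀ r β₀ : ℝ}
    (hγ₀ : 0 < γ₀) (hrem : RemainderConst S γ₀ r) (hr : r < B12Normalization.stepBal N Lc) (hcont : BetaContH γ₀ β)
    (hβ₀ : 0 < β₀) {L : ℕ} (hL2 : 2 ≤ L) (p : ℕ) {κ₀ : ℕ} (hκ : 6 ≤ κ₀) :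
    EndpointExistence Cn ∧ ∃ A : ℝ, ∃ γ₁ : ℝ, 0 < γ₁ ∧
      ∀ γ : ℝ, 0 < γ → γ ≤ min γ₀ γ₁ → ∀ Pr : B12.RunParams, (Cn Pr).flow.InInterval γ Pr.K →
        ∀ p' : ℕ, p' ≤ p → ∀ A₀ : ℝ, 0 ≤ A₀ →
          ∃ Rj : ℕ → ℕ, (∀ j, B14.IsRj L p' ((Cn Pr).flow.g j) (Rj j)) ∧
            HorizonFacts (Cn Pr).flow (B12Normalization.stepBal N Lc + 2 * A + r) β₀ A₀ L p' κ₀ Rj Pr.K :=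
  wallEND_of_cauchy_eq_JsBalOf_cont_allProfiles hLc cE cVH cΛ (WbalOf 3 Lc cE cVH cΛ T₂ mixFF) (CwOf hLc cE cVH cΛ hT₂ hmix)
    (δwOf hLc cE cVH cΛ hT₂ hmix) (δwOf_pos hLc cE cVH cΛ hT₂ hmix) (WbalOf_loc₂ hLc cE cVH cΛ hT₂ hmix) hK hKall hS hSall hW₂
    hW₂all hR hRK hRS hRW hθ0 hθ1 hident hgen hhalt hcur S hβ hγ₀ hrem hr hcont hβ₀ hL2 p hκ

/-- **THE MINIMAL [III] CARRIER OVER THE STAGE-A LITERAL FROM (CONV-C-Cauchy) + THE EXPLICIT IDENTIFICATION AT THE CONSTRUCTED LIMITS**: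
the six data binders (table rows on `WbalOf …`) + `0 ≤ θ < 1` + `hident` at `(limMKerOf (KInvStep Lc), limStOf (j ↦ (JsBal⁰_j).S),
limTabOf (WbalOf …))` + `hβ` + (D4) ⟹ `∃ A, BetaAvgAFH (stepBal N Lc − r) (2A) γ β` — `AveragedAFCarrierJsBalCauchy.betaAvgAFH_of_cauchy_eq_JsBalOf`
at `W := WbalOf …`. [cite: Balaban1987RG1, Thm 2 p.259 and §1 p.264] [cite: Balaban1988Convergent, (2.46) p.263] -/
theorem betaAvgAFH_of_cauchy_eq_JsBalW2Of
    (hK : ∀ j, Decays (KInvStep (d := 3) Lc j) C δK)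
    (hKall : ∀ k j, Decays (KInvStep (d := 3) Lc (k + j) - KInvStep (d := 3) Lc k) (cK * θ ^ k) δK)
    (hS : ∀ j, LocStencil (JsBal0Of hLc cE cVH cΛ (WbalOf 3 Lc cE cVH cΛ T₂ mixFF) (CwOf hLc cE cVH cΛ hT₂ hmix)
      (δwOf hLc cE cVH cΛ hT₂ hmix) (δwOf_pos hLc cE cVH cΛ hT₂ hmix) (WbalOf_loc₂ hLc cE cVH cΛ hT₂ hmix) j).S Cs δS)
    (hSall : ∀ k j, LocStencil
      ((JsBal0Of hLc cE cVH cΛ (WbalOf 3 Lc cE cVH cΛ T₂ mixFF) (CwOf hLc cE cVH cΛ hT₂ hmix)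
          (δwOf hLc cE cVH cΛ hT₂ hmix) (δwOf_pos hLc cE cVH cΛ hT₂ hmix) (WbalOf_loc₂ hLc cE cVH cΛ hT₂ hmix) (k + j)).S
        - (JsBal0Of hLc cE cVH cΛ (WbalOf 3 Lc cE cVH cΛ T₂ mixFF) (CwOf hLc cE cVH cΛ hT₂ hmix)
          (δwOf hLc cE cVH cΛ hT₂ hmix) (δwOf_pos hLc cE cVH cΛ hT₂ hmix) (WbalOf_loc₂ hLc cE cVH cΛ hT₂ hmix) k).S) (cS * θ ^ k) δS)
    (hW₂ : ∀ j, VertexFamily₂ (WbalOf 3 Lc cE cVH cΛ T₂ mixFF j) Lc C₂ δ₂)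
    (hW₂all : ∀ k j, VertexFamily₂ (WbalOf 3 Lc cE cVH cΛ T₂ mixFF (k + j) - WbalOf 3 Lc cE cVH cΛ T₂ mixFF k) Lc (c₂ * θ ^ k) δ₂)
    (hR : 0 < R) (hRK : R < δK) (hRS : R / 2 < δS) (hRW : R < δ₂) (hθ0 : 0 ≤ θ) (hθ1 : θ < 1) {μ ν : Fin 4} {N : ℝ}
    (hident : secondMoment (hessKer (axDressK Lc (limMKerOf (KInvStep (d := 3) Lc)))
        (axVertexOfK (limMKerOf (KInvStep (d := 3) Lc)) Lc (limStOf fun j =>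
          (JsBal0Of hLc cE cVH cΛ (WbalOf 3 Lc cE cVH cΛ T₂ mixFF) (CwOf hLc cE cVH cΛ hT₂ hmix)
            (δwOf hLc cE cVH cΛ hT₂ hmix) (δwOf_pos hLc cE cVH cΛ hT₂ hmix) (WbalOf_loc₂ hLc cE cVH cΛ hT₂ hmix) j).S))
        (limTabOf (WbalOf 3 Lc cE cVH cΛ T₂ mixFF))) μ ν = B12Normalization.stepBal N Lc)
    (S : B12Beta.OneLoopSplit β)
    (hβ : ∀ j, S.β0 j = secondMoment (TbalOf Lc (JsBalW2Of hLc cE cVH cΛ hT₂ hmix) j) μ ν) {γ r : ℝ}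
    (hrem : RemainderConst S γ r) :
    ∃ A : ℝ, BetaAvgAFH (B12Normalization.stepBal N Lc - r) (2 * A) γ β :=
  betaAvgAFH_of_cauchy_eq_JsBalOf hLc cE cVH cΛ (WbalOf 3 Lc cE cVH cΛ T₂ mixFF) (CwOf hLc cE cVH cΛ hT₂ hmix)
    (δwOf hLc cE cVH cΛ hT₂ hmix) (δwOf_pos hLc cE cVH cΛ hT₂ hmix) (WbalOf_loc₂ hLc cE cVH cΛ hT₂ hmix) hK hKall hS hSall hW₂
    hW₂all hR hRK hRS hRW hθ0 hθ1 hident S hβ hrem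

/-- **THE WHOLE LOCATED [III] LIST OVER THE STAGE-A LITERAL FROM THE EXPLICIT IDENTIFICATION AT NAMED LIMIT PRIMITIVES, ALL PROFILES** —
`AveragedAFCarrierJsBalCauchy.wallEND_of_pointwise_lim_eq_JsBalOf_cont_allProfiles` at `W := WbalOf …` (asym1's
`HessKerDressedLimit.d1Drift_JsBalOf_of_lim_eq` produces the wall `hD`): for ANY named limit primitives `(K∞, S∞, W∞)` with `j`-uniform bounds
on the UNDRESSED primitives of the literal and on the limits (`Decays (KInvStep Lc j) C δK`, `Decays K∞ C δK`, `LocStencil (JsBal⁰_j).S Cs δS`,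
`LocStencil S∞ Cs δS`, **`VertexFamily₂ (WbalOf … j) Lc C₂ δ₂`**, `VertexFamily₂ W∞ Lc C₂ δ₂`) and RATE data to them (`Decays (KInvStep Lc j − K∞)
(cK θ^j) δK`, …, **`VertexFamily₂ (WbalOf … j − W∞) Lc (c₂ θ^j) δ₂`**; `0 < R < δK`, `R/2 < δS`, `R < δ₂`; `0 ≤ θ < 1`), **THE EXPLICIT
IDENTIFICATION `hident : secondMoment (hessKer (axDressK Lc K∞) (axVertexOfK K∞ Lc S∞) W∞) μ ν = stepBal N Lc`**, then §1 ⟹ the conclusion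
of `wallEND_of_D1Drift_JsBalW2Of_cont_allProfiles`.  Discharges nothing of `BetaPertH` (`hident` is the wall, read explicitly).
[cite: Balaban1987RG1, Thm 2 p.259 and Thm 3 p.264] [cite: Balaban1988Convergent, (2.5)–(2.9) pp.255–256, (2.28) p.259, (2.46) p.263] -/
theorem wallEND_of_pointwise_lim_eq_JsBalW2Of_cont_allProfiles
    (hK : ∀ j, Decays (KInvStep (d := 3) Lc j) C δK) (hKinf : Decays Kinf C δK)
    (hKrate : ∀ j, Decays (KInvStep (d := 3) Lc j - Kinf) (cK * θ ^ j) δK)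
    (hS : ∀ j, LocStencil (JsBal0Of hLc cE cVH cΛ (WbalOf 3 Lc cE cVH cΛ T₂ mixFF) (CwOf hLc cE cVH cΛ hT₂ hmix)
      (δwOf hLc cE cVH cΛ hT₂ hmix) (δwOf_pos hLc cE cVH cΛ hT₂ hmix) (WbalOf_loc₂ hLc cE cVH cΛ hT₂ hmix) j).S Cs δS)
    (hSinf : LocStencil Sinf Cs δS)
    (hSrate : ∀ j, LocStencil
      ((JsBal0Of hLc cE cVH cΛ (WbalOf 3 Lc cE cVH cΛ T₂ mixFF) (CwOf hLc cE cVH cΛ hT₂ hmix)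
          (δwOf hLc cE cVH cΛ hT₂ hmix) (δwOf_pos hLc cE cVH cΛ hT₂ hmix) (WbalOf_loc₂ hLc cE cVH cΛ hT₂ hmix) j).S - Sinf)
      (cS * θ ^ j) δS)
    (hW₂ : ∀ j, VertexFamily₂ (WbalOf 3 Lc cE cVH cΛ T₂ mixFF j) Lc C₂ δ₂) (hWinf : VertexFamily₂ Winf Lc C₂ δ₂)
    (hWrate : ∀ j, VertexFamily₂ (WbalOf 3 Lc cE cVH cΛ T₂ mixFF j - Winf) Lc (c₂ * θ ^ j) δ₂)
    (hR : 0 < R) (hRK : R < δK) (hRS : R / 2 < δS) (hRW : R < δ₂) (hθ0 : 0 ≤ θ) (hθ1 : θ < 1) {μ ν : Fin 4} {N : ℝ}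
    (hident : secondMoment (hessKer (axDressK Lc Kinf) (axVertexOfK Kinf Lc Sinf) Winf) μ ν = B12Normalization.stepBal N Lc)
    {Cn : B12.Construction} (hgen : ForwardGenerated Cn β) (hhalt : HaltsOutside Cn β) (hcur : CurriesHBeta Cn β)
    (S : B12Beta.OneLoopSplit β)
    (hβ : ∀ j, S.β0 j = secondMoment (TbalOf Lc (JsBalW2Of hLc cE cVH cΛ hT₂ hmix) j) μ ν) {γ₀ r β₀ : ℝ}
    (hγ₀ : 0 < γ₀) (hrem : RemainderConst S γ₀ r) (hr : r < B12Normalization.stepBal N Lc) (hcont : BetaContH γ₀ β)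
    (hβ₀ : 0 < β₀) {L : ℕ} (hL2 : 2 ≤ L) (p : ℕ) {κ₀ : ℕ} (hκ : 6 ≤ κ₀) :
    EndpointExistence Cn ∧ ∃ A : ℝ, ∃ γ₁ : ℝ, 0 < γ₁ ∧
      ∀ γ : ℝ, 0 < γ → γ ≤ min γ₀ γ₁ → ∀ Pr : B12.RunParams, (Cn Pr).flow.InInterval γ Pr.K →
        ∀ p' : ℕ, p' ≤ p → ∀ A₀ : ℝ, 0 ≤ A₀ →
          ∃ Rj : ℕ → ℕ, (∀ j, B14.IsRj L p' ((Cn Pr).flow.g j) (Rj j)) ∧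
            HorizonFacts (Cn Pr).flow (B12Normalization.stepBal N Lc + 2 * A + r) β₀ A₀ L p' κ₀ Rj Pr.K :=
  wallEND_of_pointwise_lim_eq_JsBalOf_cont_allProfiles hLc cE cVH cΛ (WbalOf 3 Lc cE cVH cΛ T₂ mixFF) (CwOf hLc cE cVH cΛ hT₂ hmix)
    (δwOf hLc cE cVH cΛ hT₂ hmix) (δwOf_pos hLc cE cVH cΛ hT₂ hmix) (WbalOf_loc₂ hLc cE cVH cΛ hT₂ hmix) hK hKinf hKrate hS hSinf
    hSrate hW₂ hWinf hWrate hR hRK hRS hRW hθ0 hθ1 hident hgen hhalt hcur S hβ hγ₀ hrem hr hcont hβ₀ hL2 p hκ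

/-- **THE MINIMAL [III] CARRIER OVER THE STAGE-A LITERAL FROM THE EXPLICIT IDENTIFICATION AT NAMED LIMIT PRIMITIVES**: the bounds + rate
data to `(K∞, S∞, W∞)` (table rows on `WbalOf …`) + `0 ≤ θ < 1` + `hident` (explicit) + `hβ` + (D4) ⟹ `∃ A, BetaAvgAFH (stepBal N Lc − r) (2A) γ β`
— `AveragedAFCarrierJsBalCauchy.betaAvgAFH_of_pointwise_lim_eq_JsBalOf` at `W := WbalOf …`.
[cite: Balaban1987RG1, Thm 2 p.259 and §1 p.264] [cite: Balaban1988Convergent, (2.46) p.263] -/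
theorem betaAvgAFH_of_pointwise_lim_eq_JsBalW2Of
    (hK : ∀ j, Decays (KInvStep (d := 3) Lc j) C δK) (hKinf : Decays Kinf C δK)
    (hKrate : ∀ j, Decays (KInvStep (d := 3) Lc j - Kinf) (cK * θ ^ j) δK)
    (hS : ∀ j, LocStencil (JsBal0Of hLc cE cVH cΛ (WbalOf 3 Lc cE cVH cΛ T₂ mixFF) (CwOf hLc cE cVH cΛ hT₂ hmix)
      (δwOf hLc cE cVH cΛ hT₂ hmix) (δwOf_pos hLc cE cVH cΛ hT₂ hmix) (WbalOf_loc₂ hLc cE cVH cΛ hT₂ hmix) j).S Cs δS)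
    (hSinf : LocStencil Sinf Cs δS)
    (hSrate : ∀ j, LocStencil
      ((JsBal0Of hLc cE cVH cΛ (WbalOf 3 Lc cE cVH cΛ T₂ mixFF) (CwOf hLc cE cVH cΛ hT₂ hmix)
          (δwOf hLc cE cVH cΛ hT₂ hmix) (δwOf_pos hLc cE cVH cΛ hT₂ hmix) (WbalOf_loc₂ hLc cE cVH cΛ hT₂ hmix) j).S - Sinf)
      (cS * θ ^ j) δS)
    (hW₂ : ∀ j, VertexFamily₂ (WbalOf 3 Lc cE cVH cΛ T₂ mixFF j) Lc C₂ δ₂) (hWinf : VertexFamily₂ Winf Lc C₂ δ₂)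
    (hWrate : ∀ j, VertexFamily₂ (WbalOf 3 Lc cE cVH cΛ T₂ mixFF j - Winf) Lc (c₂ * θ ^ j) δ₂)
    (hR : 0 < R) (hRK : R < δK) (hRS : R / 2 < δS) (hRW : R < δ₂) (hθ0 : 0 ≤ θ) (hθ1 : θ < 1) {μ ν : Fin 4} {N : ℝ}
    (hident : secondMoment (hessKer (axDressK Lc Kinf) (axVertexOfK Kinf Lc Sinf) Winf) μ ν = B12Normalization.stepBal N Lc)
    (S : B12Beta.OneLoopSplit β)
    (hβ : ∀ j, S.β0 j = secondMoment (TbalOf Lc (JsBalW2Of hLc cE cVH cΛ hT₂ hmix) j) μ ν) {γ r : ℝ}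
    (hrem : RemainderConst S γ r) :
    ∃ A : ℝ, BetaAvgAFH (B12Normalization.stepBal N Lc - r) (2 * A) γ β :=
  betaAvgAFH_of_pointwise_lim_eq_JsBalOf hLc cE cVH cΛ (WbalOf 3 Lc cE cVH cΛ T₂ mixFF) (CwOf hLc cE cVH cΛ hT₂ hmix)
    (δwOf hLc cE cVH cΛ hT₂ hmix) (δwOf_pos hLc cE cVH cΛ hT₂ hmix) (WbalOf_loc₂ hLc cE cVH cΛ hT₂ hmix) hK hKinf hKrate hS hSinf
    hSrate hW₂ hWinf hWrate hR hRK hRS hRW hθ0 hθ1 hident S hβ hrem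

end LimitCurrency

/-! ## §4 Road B over the Stage-A literal: all-scales × certified list × constant remainder — NO identification, NO wall -/

section RoadB

variable {θ : ℝ}

/-- **END + THE [III] LIST OVER THE STAGE-A LITERAL ON THE ALL-SCALES × CONSTANT ROAD, ALL PROFILES, (U) DERIVED** —
`AveragedAFCarrierJsBalCauchy.allScalesConst_END_JsBalOf_allProfiles_cont` at `W := WbalOf …` (= `AveragedAFCarrierAllScales.allScalesConst_END_allProfiles_cont`
at `hall.congr hβ0`): binders `hβ0 : Sβ.β0 j = secondMoment (TbalOf Lc (JsBalW2Of …) j) μ ν`, an all-scales bound `hall` of those numbers (ANY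
supplier; NO `θ`-range, NO limit), the one-sided certified list `hlist : ∀ k ≤ k₁, m ≤ Sβ.β0 k` (cap lanes), (D4) `RemainderConst Sβ γ₀ r`, the ONE
numeric condition `r < m − κθ^{k₁}`, (C), run-side, `0 < β₀`, `L ≥ 2`, `p`, `κ₀ ≥ 6` ⟹ `EndpointExistence Cn ∧ ∃ γ₁ > 0, …, sizes ∧
HorizonFacts` with the DERIVED `β′ := Sβ.β0 0 + κ + r` — no `hup`, no `hβ′`, NO identification, NO wall.  Discharges nothing of `BetaPertH`
(`hall`'s suppliers for this literal and the certified list are the sub-cell's open rows).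
[cite: Balaban1987RG1, Thm 2 p.259 and Thm 3 p.264] [cite: Balaban1988Convergent, (2.5)–(2.9) pp.255–256, (2.28) p.259, (2.46) p.263] -/
theorem allScalesConst_END_JsBalW2Of_allProfiles_cont {Cn : B12.Construction} (hgen : ForwardGenerated Cn β)
    (hhalt : HaltsOutside Cn β) (hcur : CurriesHBeta Cn β) (Sβ : B12Beta.OneLoopSplit β) {μ ν : Fin 4} {κ : ℝ}
    (hβ0 : ∀ j, Sβ.β0 j = secondMoment (TbalOf Lc (JsBalW2Of hLc cE cVH cΛ hT₂ hmix) j) μ ν)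
    (hall : AllScalesSeq (fun j => secondMoment (TbalOf Lc (JsBalW2Of hLc cE cVH cΛ hT₂ hmix) j) μ ν) κ θ)
    {γ₀ r m : ℝ} {k₁ : ℕ} (hγ₀ : 0 < γ₀) (hlist : ∀ k, k ≤ k₁ → m ≤ Sβ.β0 k) (hrem : RemainderConst Sβ γ₀ r)
    (hr : r < m - κ * θ ^ k₁) (hcont : BetaContH γ₀ β)
    {β₀ : ℝ} (hβ₀ : 0 < β₀) {L : ℕ} (hL2 : 2 ≤ L) (p : ℕ) {κ₀ : ℕ} (hκ : 6 ≤ κ₀) :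
    EndpointExistence Cn ∧ ∃ γ₁ : ℝ, 0 < γ₁ ∧
      ∀ γ : ℝ, 0 < γ → γ ≤ min γ₀ γ₁ → ∀ Pr : B12.RunParams, (Cn Pr).flow.InInterval γ Pr.K →
        ∀ p' : ℕ, p' ≤ p → ∀ A₀ : ℝ, 0 ≤ A₀ →
          ∃ Rj : ℕ → ℕ, (∀ j, B14.IsRj L p' ((Cn Pr).flow.g j) (Rj j)) ∧
            HorizonFacts (Cn Pr).flow (Sβ.β0 0 + κ + r) β₀ A₀ L p' κ₀ Rj Pr.K :=
  allScalesConst_END_JsBalOf_allProfiles_cont hLc cE cVH cΛ (WbalOf 3 Lc cE cVH cΛ T₂ mixFF) (CwOf hLc cE cVH cΛ hT₂ hmix)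
    (δwOf hLc cE cVH cΛ hT₂ hmix) (δwOf_pos hLc cE cVH cΛ hT₂ hmix) (WbalOf_loc₂ hLc cE cVH cΛ hT₂ hmix) hgen hhalt hcur Sβ hβ0
    hall hγ₀ hlist hrem hr hcont hβ₀ hL2 p hκ

/-- **THE [III] CARRIER OVER THE STAGE-A LITERAL ON THE ALL-SCALES × CONSTANT ROAD, DEFECT ZERO**: `hβ0` + `hall` + the certified list +
(D4) ⟹ `BetaAvgAFH (m − κθ^{k₁} − r) 0 γ₀ β` (MISSING-B14 §9 Table 9.1, (all-scales) row; positive iff `r < m − κθ^{k₁}`) —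
`AveragedAFCarrierJsBalCauchy.betaAvgAFH_of_allScalesConst_JsBalOf` at `W := WbalOf …`.  No (C), no DAG, no `θ`-range, no identification.
[cite: Balaban1987RG1, Thm 2 p.259 and (2.12)–(2.14) p.268] [cite: Balaban1988Convergent, (2.46) p.263] -/
theorem betaAvgAFH_of_allScalesConst_JsBalW2Of (Sβ : B12Beta.OneLoopSplit β) {μ ν : Fin 4} {κ : ℝ}
    (hβ0 : ∀ j, Sβ.β0 j = secondMoment (TbalOf Lc (JsBalW2Of hLc cE cVH cΛ hT₂ hmix) j) μ ν)
    (hall : AllScalesSeq (fun j => secondMoment (TbalOf Lc (JsBalW2Of hLc cE cVH cΛ hT₂ hmix) j) μ ν) κ θ)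
    {γ₀ r m : ℝ} {k₁ : ℕ} (hlist : ∀ k, k ≤ k₁ → m ≤ Sβ.β0 k) (hrem : RemainderConst Sβ γ₀ r) :
    BetaAvgAFH (m - κ * θ ^ k₁ - r) 0 γ₀ β :=
  betaAvgAFH_of_allScalesConst_JsBalOf hLc cE cVH cΛ (WbalOf 3 Lc cE cVH cΛ T₂ mixFF) (CwOf hLc cE cVH cΛ hT₂ hmix)
    (δwOf hLc cE cVH cΛ hT₂ hmix) (δwOf_pos hLc cE cVH cΛ hT₂ hmix) (WbalOf_loc₂ hLc cE cVH cΛ hT₂ hmix) Sβ hβ0 hall hlist hrem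

end RoadB

/-! ## §5 The census form of the (D1) proof route (RULING (R28-1)) over the Stage-A literal: P5′ · `hbase` · (SDF) · `D1Rep` -/

section CensusForm

/-- **THE CENSUS FORM OF THE (D1) PROOF ROUTE ON THE [III] SIDE OVER THE STAGE-A LITERAL, ALL PROFILES, β′ DERIVED** —
`AveragedAFCarrierJsBal.wallEND_of_sdInvisible_D1Rep_JsBalOf_cont_allProfiles` at `W := WbalOf …` (⟸ lead `StepDriftWitness.d1Drift_of_sdInvisible_D1Rep`),
the one-shot composite family `Jc : ∀ m, JetData 3 (Lc ^ m)` a binder.  Binders: the cell's standing `h12`/`h126` BY NAME, base-point labels,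
`μ ≠ ν`, `N ≠ 0`, `2 ≤ Lc`; **P5′ of the literal's step family** (`hT0`/`hT1` of `TbalOf Lc (JsBalW2Of …) j`) and of the one-shot family
(`h𝒯0`/`h𝒯1`, `m ≥ 1`); **`hbase : TshotOf Lc Jc 1 = TbalOf Lc (JsBalW2Of …) 0`**; **(SDF) `hSF : SDInvisible Lc (JsBalW2Of …) Jc μ ν`**; window data;
**`hrep : D1Rep Lc Jc N μ ν a SL k`** — the lead's EXIT-A list «P5′ · `hbase` · (SDF-α) · P7» read over the Stage-A literal, hypotheses never
facts (RULING (R28-3)) — plus the END binders of §1 ⟹ the conclusion of §1 with `β′ := stepBal N Lc + 2A + rr`.  Discharges nothing of `BetaPertH`.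
[cite: Balaban1987RG1, Thm 2 p.259 and Thm 3 p.264] [cite: Balaban1988Convergent, (2.5)–(2.9) pp.255–256, (2.28) p.259, (2.46) p.263] -/
theorem wallEND_of_sdInvisible_D1Rep_JsBalW2Of_cont_allProfiles (a : ℝ) (ha : 0 < a)
    (h12 : B5.Prop12Printed (fam (fun i : ℕ+ × ℕ => ((i.1 : ℕ+) : ℕ)) (fun i => i.1.pos) MvE a ha))
    (h126 : B5.Kernel126_127Printed (kfam (fun i : ℕ+ × ℕ => ((i.1 : ℕ+) : ℕ)) MvE))
    {SL : Finset Λ} (hSL : SL.Nonempty) (k : Λ → Fin 4) {μ ν : Fin 4}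
    {Cn : B12.Construction} (hgen : ForwardGenerated Cn β) (hhalt : HaltsOutside Cn β) (hcur : CurriesHBeta Cn β)
    (S : B12Beta.OneLoopSplit β) (hμν : μ ≠ ν) {N : ℝ} (hN : N ≠ 0) (hL : 2 ≤ Lc)
    (Jc : ∀ m : ℕ, JetData 3 (Lc ^ m))
    (hβ : ∀ j, S.β0 j = secondMoment (TbalOf Lc (JsBalW2Of hLc cE cVH cΛ hT₂ hmix) j) μ ν)
    (hT0 : ∀ j (c e : Fin 4), HasSum (TbalOf Lc (JsBalW2Of hLc cE cVH cΛ hT₂ hmix) j c e) 0)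
    (hT1 : ∀ j (c e ρ : Fin 4),
      HasSum (fun t : Fin 4 → ℤ => t ρ • TbalOf Lc (JsBalW2Of hLc cE cVH cΛ hT₂ hmix) j c e t) 0)
    (h𝒯0 : ∀ m, 1 ≤ m → ∀ c e : Fin 4, HasSum (TshotOf Lc Jc m c e) 0)
    (h𝒯1 : ∀ m, 1 ≤ m → ∀ c e ρ : Fin 4, HasSum (fun t : Fin 4 → ℤ => t ρ • TshotOf Lc Jc m c e t) 0)
    (hbase : TshotOf Lc Jc 1 = TbalOf Lc (JsBalW2Of hLc cE cVH cΛ hT₂ hmix) 0)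
    (hSF : SDInvisible Lc (JsBalW2Of hLc cE cVH cΛ hT₂ hmix) Jc μ ν)
    {cc : ℝ} {M : ℕ → ℕ}
    (hc : 1 ≤ cc) (hM : ∀ L : ℕ, 2 ≤ L → 1 ≤ M L ∧ (L : ℝ) ≤ cc * M L) (hML : ∀ L : ℕ, 2 ≤ L → M L ≤ L)
    (hrep : D1Rep Lc Jc N μ ν a SL k)
    {rr γ₀ β₀ : ℝ} (hγ₀ : 0 < γ₀) (hrem : RemainderConst S γ₀ rr) (hr : rr < B12Normalization.stepBal N Lc)
    (hcont : BetaContH γ₀ β) (hβ₀ : 0 < β₀) {L : ℕ} (hL2 : 2 ≤ L) (p : ℕ) {κ₀ : ℕ} (hκ : 6 ≤ κ₀) :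
    EndpointExistence Cn ∧ ∃ A : ℝ, ∃ γ₁ : ℝ, 0 < γ₁ ∧
      ∀ γ : ℝ, 0 < γ → γ ≤ min γ₀ γ₁ → ∀ Pr : B12.RunParams, (Cn Pr).flow.InInterval γ Pr.K →
        ∀ p' : ℕ, p' ≤ p → ∀ A₀ : ℝ, 0 ≤ A₀ →
          ∃ Rj : ℕ → ℕ, (∀ j, B14.IsRj L p' ((Cn Pr).flow.g j) (Rj j)) ∧
            HorizonFacts (Cn Pr).flow (B12Normalization.stepBal N Lc + 2 * A + rr) β₀ A₀ L p' κ₀ Rj Pr.K :=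
  wallEND_of_sdInvisible_D1Rep_JsBalOf_cont_allProfiles hLc cE cVH cΛ (WbalOf 3 Lc cE cVH cΛ T₂ mixFF) (CwOf hLc cE cVH cΛ hT₂ hmix)
    (δwOf hLc cE cVH cΛ hT₂ hmix) (δwOf_pos hLc cE cVH cΛ hT₂ hmix) (WbalOf_loc₂ hLc cE cVH cΛ hT₂ hmix) a ha h12 h126 hSL k hgen
    hhalt hcur S hμν hN hL Jc hβ hT0 hT1 h𝒯0 h𝒯1 hbase hSF hc hM hML hrep hγ₀ hrem hr hcont hβ₀ hL2 p hκ

/-- **THE MINIMAL [III] CARRIER FROM THE CENSUS FORM OVER THE STAGE-A LITERAL**: the binders of `d1Drift_of_sdInvisible_D1Rep` at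
`Js := JsBalW2Of …` + `hβ` + (D4) ⟹ `∃ A, BetaAvgAFH (stepBal N Lc − rr) (2A) γ β` — `AveragedAFCarrierJsBal.betaAvgAFH_of_sdInvisible_D1Rep_JsBalOf`
at `W := WbalOf …`. [cite: Balaban1987RG1, Thm 2 p.259 and §1 p.264] [cite: Balaban1988Convergent, (2.46) p.263] -/
theorem betaAvgAFH_of_sdInvisible_D1Rep_JsBalW2Of (a : ℝ) (ha : 0 < a)
    (h12 : B5.Prop12Printed (fam (fun i : ℕ+ × ℕ => ((i.1 : ℕ+) : ℕ)) (fun i => i.1.pos) MvE a ha))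
    (h126 : B5.Kernel126_127Printed (kfam (fun i : ℕ+ × ℕ => ((i.1 : ℕ+) : ℕ)) MvE))
    {SL : Finset Λ} (hSL : SL.Nonempty) (k : Λ → Fin 4) {μ ν : Fin 4}
    (S : B12Beta.OneLoopSplit β) (hμν : μ ≠ ν) {N : ℝ} (hN : N ≠ 0) (hL : 2 ≤ Lc)
    (Jc : ∀ m : ℕ, JetData 3 (Lc ^ m))
    (hβ : ∀ j, S.β0 j = secondMoment (TbalOf Lc (JsBalW2Of hLc cE cVH cΛ hT₂ hmix) j) μ ν)
    (hT0 : ∀ j (c e : Fin 4), HasSum (TbalOf Lc (JsBalW2Of hLc cE cVH cΛ hT₂ hmix) j c e) 0)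
    (hT1 : ∀ j (c e ρ : Fin 4),
      HasSum (fun t : Fin 4 → ℤ => t ρ • TbalOf Lc (JsBalW2Of hLc cE cVH cΛ hT₂ hmix) j c e t) 0)
    (h𝒯0 : ∀ m, 1 ≤ m → ∀ c e : Fin 4, HasSum (TshotOf Lc Jc m c e) 0)
    (h𝒯1 : ∀ m, 1 ≤ m → ∀ c e ρ : Fin 4, HasSum (fun t : Fin 4 → ℤ => t ρ • TshotOf Lc Jc m c e t) 0)
    (hbase : TshotOf Lc Jc 1 = TbalOf Lc (JsBalW2Of hLc cE cVH cΛ hT₂ hmix) 0)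
    (hSF : SDInvisible Lc (JsBalW2Of hLc cE cVH cΛ hT₂ hmix) Jc μ ν)
    {cc : ℝ} {M : ℕ → ℕ}
    (hc : 1 ≤ cc) (hM : ∀ L : ℕ, 2 ≤ L → 1 ≤ M L ∧ (L : ℝ) ≤ cc * M L) (hML : ∀ L : ℕ, 2 ≤ L → M L ≤ L)
    (hrep : D1Rep Lc Jc N μ ν a SL k) {γ rr : ℝ} (hrem : RemainderConst S γ rr) :
    ∃ A : ℝ, BetaAvgAFH (B12Normalization.stepBal N Lc - rr) (2 * A) γ β :=
  betaAvgAFH_of_sdInvisible_D1Rep_JsBalOf hLc cE cVH cΛ (WbalOf 3 Lc cE cVH cΛ T₂ mixFF) (CwOf hLc cE cVH cΛ hT₂ hmix)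
    (δwOf hLc cE cVH cΛ hT₂ hmix) (δwOf_pos hLc cE cVH cΛ hT₂ hmix) (WbalOf_loc₂ hLc cE cVH cΛ hT₂ hmix) a ha h12 h126 hSL k S hμν
    hN hL Jc hβ hT0 hT1 h𝒯0 h𝒯1 hbase hSF hc hM hML hrep hrem

end CensusForm

end Literature.MathematicalPhysics.QuantumFieldTheory.Balaban1983to89.Beta.AveragedAFCarrierJsBalW2

end
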